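/-
Width seat `ym-line-cbag-p1-w3` (prover-ym-line-cbag-p1-w3-g10-0; own items stmt-QuantumFields-22254 / 22893 CLOSED proved).  Glue towards
the TWO-SIDED six-plane DLR transfer (node `Theorems.TreeLevelLimitWitness`): the torus-mean excess over the cold-box centre mean with an
EXPLICIT exponent `β^{−(1+3θ)}` at every scale `θ ≤ θ₂(G, r)`.  RECORD-type material; the Yang–Mills mass gap is NOT proved by anything here.
-/
import Summits.QuantumFields.YangMills.Theorems.SixPlaneColdBoxTorusMeanNearTopBox

/-!
# Route `SixPlaneColdBox`, glue: the torus-mean excess with an explicit exponent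

The crux `TorusMeanNearColdBoxG` (proved, `torusMeanNearColdBoxG_proof`) exposes its margin only existentially (`∃ m > 0`, excess
`≤ β^{−(1+4A+m)}`).  A two-sided DLR transfer must play this margin against the sup of the kernel-mean excess over crude-good data
(`≍ β^{2θ/5}` in `β`-units), so it needs the margin as a FORMULA in `θ`.  This file re-runs the (short) argument of `torusMeanNearTopBoxG` with
explicit bookkeeping:

* **`torusMean_sub_boxMean_le_rpow`** — for every compact simple `G` and `r : LatticeRep G` there is `θ₂ ∈ (0, 1/200]`
  (`θ₂ = min (1/200) (κ'/8)`, `κ'` the rate of `equipartitionRate_upper` through `limitMean_le`) such that for every `0 < θ ≤ θ₂`, for all large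
  `β` and then all large odd tori `2S+1`, in every plane `i < j`,
  `E_{torus}[c_{(0;i,j)}] − E_{box ⌈β^θ⌉}[c_{(centre;i,j)}] ≤ β^{−(1+3θ)}`
  (torus side: `limitMean_le` + compactness `eventually_torusMean_le`; box side: `boxMean_centre_ge`; the three error pieces `Cₑβ^{−κ'}`,
  `(3D)K/⌈β^θ⌉⁴ ≤ (3D)Kβ^{−4θ}`, `21β^{−1/4}` and the compactness slack are each `≤ β^{−3θ}/4` eventually since `3θ < min(κ', 4θ, 1/4)`).

No sorry; no definition; standard axioms.  NOT the Yang–Mills mass gap: a statement about plaquette MEANS at next-to-leading precision.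
-/

set_option autoImplicit false

noncomputable section

open MeasureTheory ProbabilityTheory Finset Real Filter Topology Metric
open scoped ENNReal
open Literature.Probability.LatticeModels (Site)
open Literature.MathematicalPhysics.QuantumLattice
open Literature.MathematicalPhysics.QuantumFieldTheory
open Summit.QuantumFields.YangMills.Theorems.WeakCouplingRates
open Summit.QuantumFields.YangMills.Theorems.FreeEnergyLogCoefficient
open Summit.QuantumFields.YangMills.Theorems.ColdBoxAllGroups

namespace Summit.QuantumFields.YangMills.Theorems.SixPlaneColdBox

/-- **The torus-mean excess over the cold-box centre mean, explicit exponent.**  For every compact simple `G` and `r : LatticeRep G` there is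
`θ₂ ∈ (0, 1/200]` such that for every `0 < θ ≤ θ₂`, for all large `β`, then all large odd tori `2S+1`, and every plane `i < j`:
`∫ plaqCost0 (i,j) ∘ torusLift d(wilsonMeasure) − ∫ plaqCostAt (boxCentre ⌈β^θ⌉) (i,j) d(boxState β ⌈β^θ⌉) ≤ β^{−(1+3θ)}`. -/
theorem torusMean_sub_boxMean_le_rpow :
    ∀ (G : Type) [Group G] [TopologicalSpace G] [IsTopologicalGroup G] [CompactSpace G],
      IsCompactSimpleLieGroup G →
        letI : MeasurableSpace G := borel G
        haveI : BorelSpace G := ⟨rfl⟩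
        ∀ r : LatticeRep G, ∃ θ₂ : ℝ, 0 < θ₂ ∧ θ₂ ≤ 1 / 200 ∧ ∀ θ : ℝ, 0 < θ → θ ≤ θ₂ →
          ∃ β₀ : ℝ, ∀ β : ℝ, β₀ ≤ β → ∃ S₀ : ℕ, ∀ S : ℕ, S₀ ≤ S → ∀ i j : Fin 4, i < j →
            (∫ U, plaqCost0 r.ρ i j (torusLift (2 * S + 1) U) ∂(wilsonMeasure (d := 4) (L := 2 * S + 1) r.ρ β)) -
                (∫ U, plaqCostAt r.ρ (boxCentre ⌈β ^ θ⌉₊) i j U ∂(boxState r.ρ β ⌈β ^ θ⌉₊)) ≤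
              β ^ (-(1 + 3 * θ)) := by
  intro G _ _ _ _ hG
  letI : MeasurableSpace G := borel G
  haveI : BorelSpace G := ⟨rfl⟩
  intro r
  haveI : SecondCountableTopology G := r.secondCountableTopology
  haveI : T2Space G := (r.continuous.isClosedEmbedding r.injective).isEmbedding.t2Space
  have hρc : Continuous r.ρ := r.continuous
  obtain ⟨Cₑ, κ', hκ', hrest⟩ := limitMean_le G hG r
  -- the ceiling
  set θ₂ : ℝ := min (1 / 200) (κ' / 8) with hθ₂
  have hθ₂0 : 0 < θ₂ := lt_min (by norm_num) (by positivity)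
  have hθ₂1 : θ₂ ≤ 1 / 200 := min_le_left _ _
  have hθ₂2 : θ₂ ≤ κ' / 8 := min_le_right _ _
  refine ⟨θ₂, hθ₂0, hθ₂1, fun θ hθ hθθ₂ => ?_⟩
  have hθ1 : θ ≤ 1 / 200 := hθθ₂.trans hθ₂1
  obtain ⟨K, β₁, hK0, hup⟩ := hrest θ hθ hθ1
  obtain ⟨Kb, hKb0, βb, hbox⟩ := boxMean_centre_ge G hG r hθ hθ1
  -- the excess exponent `s = 3θ`
  set s : ℝ := 3 * θ with hs
  have hs0 : 0 < s := by rw [hs]; positivity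
  have hgap1 : -κ' < -s := by rw [hs]; linarith
  have hgap2 : -(4 * θ) < -s := by rw [hs]; linarith
  have hgap3 : -(1 / 4 : ℝ) < -s := by rw [hs]; linarith
  set D : ℝ := (dimE r.ρ : ℝ) with hD
  have hD0 : 0 ≤ D := Nat.cast_nonneg _
  obtain ⟨βp1, hβp1_1, hp1⟩ := exists_const_mul_rpow_le_rpow (4 * |Cₑ|) hgap1
  obtain ⟨βp2, -, hp2⟩ := exists_const_mul_rpow_le_rpow (4 * (5 * (D / 2) * K + D / 2 * Kb)) hgap2
  obtain ⟨βp3, -, hp3⟩ := exists_const_mul_rpow_le_rpow (4 * 21) hgap3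
  refine ⟨max (max β₁ βb) (max (max βp1 βp2) (max βp3 1)), fun β hβ => ?_⟩
  simp only [max_le_iff] at hβ
  obtain ⟨⟨hb1, hbb⟩, ⟨hbp1, hbp2⟩, hbp3, hβ1⟩ := hβ
  have hβ0 : 0 < β := by linarith
  -- the slack `δ := β^{-(1+s)}/4` and the torus side on large tori, every plane
  set δ : ℝ := β ^ (-(1 + s)) / 4 with hδ
  have hδ0 : 0 < δ := by positivity
  set B : {q : Fin 4 × Fin 4 // q.1 < q.2} → ℝ := fun _ =>
    ((D / 4 + Cₑ * β ^ (-κ') + 5 * (D / 2 * (K / (⌈β ^ θ⌉₊ : ℝ) ^ 4)) + 20 * β ^ (-(1 / 4 : ℝ))) / β) with hB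
  have hBlim : ∀ (q : {q : Fin 4 × Fin 4 // q.1 < q.2}), ∀ ν ∈ infiniteVolumeLimitPoints (d := 4) r.ρ β,
      ∫ U, ((r.N : ℝ) - plaquetteObs r.ρ 0 q.1.1 q.1.2 U) ∂ν ≤ B q := by
    intro q ν hν
    have h := hup β hb1 ν hν q
    rw [hB, le_div_iff₀ hβ0, mul_comm]
    exact h
  choose S₀ hS₀ using fun q : {q : Fin 4 × Fin 4 // q.1 < q.2} => eventually_torusMean_le r.ρ hρc β hδ0 q (hBlim q)
  refine ⟨Finset.univ.sup S₀, fun S hS i j hij => ?_⟩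
  set q : {q : Fin 4 × Fin 4 // q.1 < q.2} := ⟨(i, j), hij⟩ with hq
  have hSq : S₀ q ≤ S := (Finset.le_sup (Finset.mem_univ q)).trans hS
  have hT : (∫ U, plaqCost0 r.ρ i j (torusLift (2 * S + 1) U) ∂(wilsonMeasure (d := 4) (L := 2 * S + 1) r.ρ β)) ≤ B q + δ :=
    hS₀ q S hSq
  -- the box side
  have hBx := hbox β hbb i j hij
  -- `1/⌈β^θ⌉⁴ ≤ β^{-4θ}`
  have hHge : β ^ θ ≤ (⌈β ^ θ⌉₊ : ℝ) := Nat.le_ceil _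
  have hHpos : 0 < (⌈β ^ θ⌉₊ : ℝ) := lt_of_lt_of_le (Real.rpow_pos_of_pos hβ0 _) hHge
  have hH4 : 1 / (⌈β ^ θ⌉₊ : ℝ) ^ 4 ≤ β ^ (-(4 * θ)) := by
    have h1 : (β ^ θ) ^ 4 ≤ (⌈β ^ θ⌉₊ : ℝ) ^ 4 := pow_le_pow_left₀ (by positivity) hHge 4
    have h2 : (β ^ θ) ^ 4 = β ^ (4 * θ) := by
      rw [← Real.rpow_natCast (β ^ θ) 4, ← Real.rpow_mul hβ0.le]; norm_num; ring_nf
    rw [h2] at h1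
    rw [div_le_iff₀ (by positivity), Real.rpow_neg hβ0.le]
    have h3 : 0 < β ^ (4 * θ) := by positivity
    calc (1 : ℝ) = (β ^ (4 * θ))⁻¹ * β ^ (4 * θ) := by rw [inv_mul_cancel₀ h3.ne']
      _ ≤ (β ^ (4 * θ))⁻¹ * (⌈β ^ θ⌉₊ : ℝ) ^ 4 := mul_le_mul_of_nonneg_left h1 (by positivity)
  -- the three error pieces against `β^{-s}/4`
  have e1 : |Cₑ| * β ^ (-κ') ≤ β ^ (-s) / 4 := by have := hp1 β hbp1; linarith
  have e2 : (5 * (D / 2) * K + D / 2 * Kb) * β ^ (-(4 * θ)) ≤ β ^ (-s) / 4 := by have := hp2 β hbp2; linarith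
  have e3 : 21 * β ^ (-(1 / 4 : ℝ)) ≤ β ^ (-s) / 4 := by have := hp3 β hbp3; linarith
  have eδ : β * δ = β ^ (-s) / 4 := by
    rw [hδ, show -(1 + s) = -s + (-1 : ℝ) by ring, Real.rpow_add hβ0, Real.rpow_neg_one]
    field_simp
  -- `β·(E_S − E_box) ≤ β^{-s}`
  have hCe : Cₑ * β ^ (-κ') ≤ |Cₑ| * β ^ (-κ') := mul_le_mul_of_nonneg_right (le_abs_self _) (by positivity)
  have hKH : 5 * (D / 2 * (K / (⌈β ^ θ⌉₊ : ℝ) ^ 4)) + D / 2 * (Kb / (⌈β ^ θ⌉₊ : ℝ) ^ 4) ≤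
      (5 * (D / 2) * K + D / 2 * Kb) * β ^ (-(4 * θ)) := by
    have e : 5 * (D / 2 * (K / (⌈β ^ θ⌉₊ : ℝ) ^ 4)) + D / 2 * (Kb / (⌈β ^ θ⌉₊ : ℝ) ^ 4) =
        (5 * (D / 2) * K + D / 2 * Kb) * (1 / (⌈β ^ θ⌉₊ : ℝ) ^ 4) := by ring
    rw [e]
    exact mul_le_mul_of_nonneg_left hH4 (by positivity)
  have hTβ : β * (∫ U, plaqCost0 r.ρ i j (torusLift (2 * S + 1) U) ∂(wilsonMeasure (d := 4) (L := 2 * S + 1) r.ρ β)) ≤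
      D / 4 + Cₑ * β ^ (-κ') + 5 * (D / 2 * (K / (⌈β ^ θ⌉₊ : ℝ) ^ 4)) + 20 * β ^ (-(1 / 4 : ℝ)) + β * δ := by
    have h := mul_le_mul_of_nonneg_left hT hβ0.le
    have e : β * (B q + δ) = D / 4 + Cₑ * β ^ (-κ') + 5 * (D / 2 * (K / (⌈β ^ θ⌉₊ : ℝ) ^ 4)) + 20 * β ^ (-(1 / 4 : ℝ)) + β * δ := by
      rw [hB]; field_simp
    linarith
  have key : β * ((∫ U, plaqCost0 r.ρ i j (torusLift (2 * S + 1) U) ∂(wilsonMeasure (d := 4) (L := 2 * S + 1) r.ρ β)) -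
      (∫ U, plaqCostAt r.ρ (boxCentre ⌈β ^ θ⌉₊) i j U ∂(boxState r.ρ β ⌈β ^ θ⌉₊))) ≤ β ^ (-s) := by
    rw [mul_sub]
    linarith [hTβ, hBx, hCe, hKH, e1, e2, e3, eδ]
  -- divide by `β`
  have hfin : (∫ U, plaqCost0 r.ρ i j (torusLift (2 * S + 1) U) ∂(wilsonMeasure (d := 4) (L := 2 * S + 1) r.ρ β)) -
      (∫ U, plaqCostAt r.ρ (boxCentre ⌈β ^ θ⌉₊) i j U ∂(boxState r.ρ β ⌈β ^ θ⌉₊)) ≤ β ^ (-s) / β := by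
    rw [le_div_iff₀ hβ0, mul_comm]; exact key
  have epow : β ^ (-s) / β = β ^ (-(1 + 3 * θ)) := by
    have e : -(1 + 3 * θ) = -s + (-1 : ℝ) := by rw [hs]; ring
    rw [e, Real.rpow_add hβ0, Real.rpow_neg_one, div_eq_mul_inv]
  rw [← epow]; exact hfin

end Summit.QuantumFields.YangMills.Theorems.SixPlaneColdBox

end
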